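import Literature.NumberTheory.LFunctions.RayClassLSeriesZeroCount
import HarnessLib

/-!
# The local partial fraction of `L'/L(s, χ)` on discs, uniformly in the field and the modulus
# (Lagarias–Odlyzko Lemma 5.6 for Hecke `L`-series of primitive ray class characters)

Topic `Literature/NumberTheory/LFunctions`; namespace `Literature.NumberTheory.LFunctions`.  Pure-proof
companion of `RayClassLSeriesZeroCount.lean`; the ray-class analogue (conductor `𝔣 = 𝔪`) of
`norm_logDeriv_classTwistedZeta₁_sub_sum_le` (`ClassGroupLFunctionZeroCount.lean`, conductor `1`).
Everything here is PROVED; no definition and no named fact is introduced.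

For a primitive ray class character `χ mod 𝔪 ≠ 0` of sign type `p`, non-principal on the ideals prime to `𝔪`,
its entire continuation `L`, a height `t` and `M = log(|d_K| 𝔑𝔪) + 3n_K + n_K log(|t| + 7)`:

* `sum_divisor_continuation_bigDisc_le` — at most `32 M` zeros of `L` (with multiplicity) in `|s − (2+it)| ≤ 31/16`;
* `norm_logDeriv_continuation_sub_sum_le` — **the local partial fraction** ([LagariasOdlyzko1977, Lemma 5.6]
  "`L'/L(s, χ) = Σ_{|ρ − s₀| ≤ 1} 1/(s − ρ) + O(log A(χ) + n_K log(|t| + 2))`", disc form with absolute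
  constants): for `|s − (2 + it)| ≤ 7/4` with `L(s) ≠ 0`,
  `|L'/L(s) − Σ_ρ m(ρ)/(s − ρ)| ≤ 77760 · M` over the zeros `ρ` of `L` in `|ρ − (2 + it)| ≤ 31/16`
  (Landau's lemma, the tree's `Literature.Analysis.Complex.norm_logDeriv_sub_sum_le`, radii `7/4 < 15/8 < 31/16 < 2`).

## References

* J. C. Lagarias, A. M. Odlyzko, *Effective versions of the Chebotarev density theorem* (1977), Lemma 5.6.
  [LagariasOdlyzko1977]
* J. Thorner, A. Zaman, *A unified and improved Chebotarev density theorem*, ANT 13 (2019), §2.3, Lemma 2.6.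
  [ThornerZaman2019]
-/

noncomputable section

open Complex NumberField NumberField.InfinitePlace NumberField.Units IsDedekindDomain Filter Topology Set Metric
  MeromorphicOn
open scoped NumberField nonZeroDivisors
open scoped Classical

namespace Literature.NumberTheory.LFunctions

variable {K : Type*} [Field K] [NumberField K]
variable {𝔪 : Ideal (𝓞 K)} {ψ : HeightOneSpectrum (𝓞 K) → ℂ} {p : Finset {w : InfinitePlace K // IsReal w}}

/-- The zero-count bound `M = log(|d_K| 𝔑𝔪) + 3n + n log(|t|+7)` is `≥ 1`. [folklore] -/
private theorem one_le_rayClassDiscBound (h𝔪 : 𝔪 ≠ ⊥) (t : ℝ) :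
    1 ≤ Real.log (|(discr K : ℝ)| * (Ideal.absNorm 𝔪 : ℝ)) + 3 * Module.finrank ℚ K +
      Module.finrank ℚ K * Real.log (|t| + 7) := by
  have hA1 : 1 ≤ |(discr K : ℝ)| * (Ideal.absNorm 𝔪 : ℝ) := by
    have h1 : (1 : ℝ) ≤ |(discr K : ℝ)| := by
      have := Int.one_le_abs (discr_ne_zero K)
      rw [← Int.cast_abs]; exact_mod_cast this
    have h2 : (1 : ℝ) ≤ (Ideal.absNorm 𝔪 : ℝ) := by
      exact_mod_cast Nat.one_le_iff_ne_zero.mpr (by rwa [ne_eq, Ideal.absNorm_eq_zero_iff])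
    nlinarith
  have h1 := Real.log_nonneg hA1
  have h2 : 0 ≤ Real.log (|t| + 7) := Real.log_nonneg (by linarith [abs_nonneg t])
  have hn : (1 : ℝ) ≤ Module.finrank ℚ K := by exact_mod_cast Module.finrank_pos
  nlinarith

/-- Jensen in the disc of radius `31/16`: at most `32 M` zeros of `L`, with multiplicity (`log(32/31) ≥ 1/32`).
[cite: ThornerZaman2019, Lemma 2.5] -/
theorem sum_divisor_continuation_bigDisc_le (hψ : IsRayClassCharacter 𝔪 ψ) (hprim : IsPrimitive 𝔪 ψ)
    (hp : IsSignType 𝔪 ψ p) (h𝔪 : 𝔪 ≠ ⊥)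
    (hnt : ∃ v : HeightOneSpectrum (𝓞 K), ¬ 𝔪 ≤ v.asIdeal ∧ ψ v ≠ 1)
    {L : ℂ → ℂ} (hL : Differentiable ℂ L) (hLs : ∀ s : ℂ, 1 < s.re → L s = rayClassLSeries 𝔪 ψ s)
    (t : ℝ) :
    ∑ u ∈ ((divisor L (closedBall (2 + t * I) (31 / 16))).finiteSupport (isCompact_closedBall _ _)).toFinset,
      (divisor L (closedBall (2 + t * I) (31 / 16)) u : ℝ) ≤
        32 * (Real.log (|(discr K : ℝ)| * (Ideal.absNorm 𝔪 : ℝ)) + 3 * Module.finrank ℚ K +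
          Module.finrank ℚ K * Real.log (|t| + 7)) := by
  set D := divisor L (closedBall (2 + t * I) (31 / 16)) with hD
  have hfin : (Function.support D).Finite := D.finiteSupport (isCompact_closedBall _ _)
  have hsum : ∑ u ∈ hfin.toFinset, (D u : ℝ) = ∑ᶠ u, (D u : ℝ) := by
    rw [finsum_eq_sum_of_support_subset (fun u => (D u : ℝ)) (s := hfin.toFinset) ?_]
    intro u hu
    simp only [Function.mem_support, ne_eq, Int.cast_eq_zero] at hu
    simpa using hu
  rw [hsum]
  have hJ := finsum_divisor_continuation_le hψ hprim hp h𝔪 hnt hL hLs t (r := 31 / 16) (by norm_num) (by norm_num)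
  refine hJ.trans ?_
  have hlog : 1 / 32 ≤ Real.log (2 / (31 / 16)) := by
    have := Real.one_sub_inv_le_log_of_pos (x := 2 / (31 / 16)) (by norm_num)
    norm_num at this ⊢
    linarith
  have hM := one_le_rayClassDiscBound (K := K) h𝔪 t
  rw [div_le_iff₀ (by linarith)]
  nlinarith

set_option maxHeartbeats 800000 in
/-- **The local partial fraction of `L'/L`, uniformly in `K`, `𝔪`, `χ`** ([LagariasOdlyzko1977, Lemma 5.6] /
[ThornerZaman2019, Lemma 2.6], disc form): for `|s − (2 + it)| ≤ 7/4` with `L(s) ≠ 0`,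
`|L'/L(s) − Σ_ρ m(ρ)/(s − ρ)| ≤ 77760 · (log(|d_K| 𝔑𝔪) + 3n_K + n_K log(|t| + 7))`, the sum over the zeros `ρ` of
the entire continuation `L` of `L(χ, ·)` in `|ρ − (2 + it)| ≤ 31/16` with multiplicities.
[cite: LagariasOdlyzko1977, Lemma 5.6] -/
theorem norm_logDeriv_continuation_sub_sum_le (hψ : IsRayClassCharacter 𝔪 ψ) (hprim : IsPrimitive 𝔪 ψ)
    (hp : IsSignType 𝔪 ψ p) (h𝔪 : 𝔪 ≠ ⊥)
    (hnt : ∃ v : HeightOneSpectrum (𝓞 K), ¬ 𝔪 ≤ v.asIdeal ∧ ψ v ≠ 1)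
    {L : ℂ → ℂ} (hL : Differentiable ℂ L) (hLs : ∀ s : ℂ, 1 < s.re → L s = rayClassLSeries 𝔪 ψ s)
    (t : ℝ) {s : ℂ} (hs : s ∈ closedBall (2 + t * I) (7 / 4)) (hfs : L s ≠ 0) :
    ‖logDeriv L s -
        ∑ u ∈ ((divisor L (closedBall (2 + t * I) (31 / 16))).finiteSupport (isCompact_closedBall _ _)).toFinset,
          (divisor L (closedBall (2 + t * I) (31 / 16)) u : ℂ) / (s - u)‖ ≤
      77760 * (Real.log (|(discr K : ℝ)| * (Ideal.absNorm 𝔪 : ℝ)) + 3 * Module.finrank ℚ K +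
        Module.finrank ℚ K * Real.log (|t| + 7)) := by
  -- the disc bound, transferred to `L` by uniqueness of the continuation
  obtain ⟨L₀, hL₀d, hL₀s, hL₀b⟩ := exists_continuation_norm_le_of_mem_closedBall hψ hprim hp h𝔪 hnt
  have hLL : L = L₀ := by
    have h := AnalyticOnNhd.eqOn_of_preconnected_of_eventuallyEq (𝕜 := ℂ)
      (hL.differentiableOn.analyticOnNhd isOpen_univ) (hL₀d.differentiableOn.analyticOnNhd isOpen_univ)
      isPreconnected_univ (Set.mem_univ (2 : ℂ)) ?_
    · exact funext fun z ↦ h (Set.mem_univ z)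
    · refine eventually_of_mem ((continuous_re.isOpen_preimage _ isOpen_Ioi).mem_nhds (by simp : 1 < (2 : ℂ).re))
        fun z (hz : 1 < z.re) ↦ ?_
      rw [hLs z hz, hL₀s z hz]
  subst hLL
  set n : ℕ := Module.finrank ℚ K with hn
  set c : ℂ := 2 + t * I with hc
  set A : ℝ := |(discr K : ℝ)| * (Ideal.absNorm 𝔪 : ℝ) with hA
  set B : ℝ := A * Real.exp (2 * n) * (|t| + 7) ^ n with hB
  set M : ℝ := Real.log A + 3 * n + n * Real.log (|t| + 7) with hM
  have hM1 : 1 ≤ M := one_le_rayClassDiscBound (K := K) h𝔪 t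
  -- `L(c) ≠ 0`, `log(B/|L c|) ≤ M`
  have hc2 : 1 < c.re := by rw [hc]; simp
  have hfc : Real.exp (-(n : ℝ)) ≤ ‖L c‖ := by
    rw [hL₀s c hc2]
    have h := exp_neg_finrank_div_le_norm_rayClassLSeries h𝔪 (fun v hv ↦ (hψ.norm_eq_one v hv).le) hc2
    have hre : c.re = 2 := by rw [hc]; simp
    rwa [hre, show (2 : ℝ) - 1 = 1 by norm_num, div_one] at h
  have hfpos : 0 < ‖L c‖ := (Real.exp_pos _).trans_le hfc
  have hc0 : L c ≠ 0 := fun h ↦ by rw [h, norm_zero] at hfpos; exact lt_irrefl _ hfpos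
  have hlogB : Real.log (B / ‖L c‖) ≤ M := by
    have hA0 : 0 < A := by
      have h1 : (1 : ℝ) ≤ |(discr K : ℝ)| := by
        have := Int.one_le_abs (discr_ne_zero K)
        rw [← Int.cast_abs]; exact_mod_cast this
      have h2 : (1 : ℝ) ≤ (Ideal.absNorm 𝔪 : ℝ) := by
        exact_mod_cast Nat.one_le_iff_ne_zero.mpr (by rwa [ne_eq, Ideal.absNorm_eq_zero_iff])
      rw [hA]; nlinarith
    have ht7 : (0 : ℝ) < |t| + 7 := by linarith [abs_nonneg t]
    rw [Real.log_div (by positivity) hfpos.ne', hB, Real.log_mul (by positivity) (by positivity),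
      Real.log_mul hA0.ne' (by positivity), Real.log_exp, Real.log_pow]
    have hlogf : -(n : ℝ) ≤ Real.log ‖L c‖ := by
      rw [← Real.log_exp (-(n : ℝ))]; exact Real.log_le_log (Real.exp_pos _) hfc
    rw [hM]; linarith
  have h := Literature.Analysis.Complex.norm_logDeriv_sub_sum_le (f := L) (c := c)
    (r := 7 / 4) (r₁ := 15 / 8) (R₂ := 31 / 16) (R := 2) (B := B)
    (by norm_num) (by norm_num) (by norm_num) (by norm_num)
    ((hL.differentiableOn.analyticOnNhd isOpen_univ).mono (Set.subset_univ _)) hc0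
    (fun z hz ↦ hL₀b t z hz) hs hfs
  set D := divisor L (closedBall c (31 / 16)) with hD
  set S := (D.finiteSupport (isCompact_closedBall c (31 / 16))).toFinset with hS
  set N : ℝ := ∑ u ∈ S, (D u : ℝ) with hN
  have hN32 : N ≤ 32 * M := sum_divisor_continuation_bigDisc_le hψ hprim hp h𝔪 hnt hL hL₀s t
  have hlog32 : Real.log (2 / (2 - 31 / 16)) ≤ 5 := by
    rw [show (2 : ℝ) / (2 - 31 / 16) = 32 by norm_num]
    exact log_thirtyTwo_le_five
  have hD0 : ∀ u, 0 ≤ D u := fun u ↦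
    ((hL.differentiableOn.analyticOnNhd isOpen_univ).mono (Set.subset_univ (closedBall c (31 / 16)))).divisor_nonneg u
  have hN0 : 0 ≤ N := Finset.sum_nonneg fun u _ ↦ by exact_mod_cast hD0 u
  refine h.trans ?_
  have hK : 2 * (15 / 8 : ℝ) / ((31 / 16 - 15 / 8) * (15 / 8 - 7 / 4)) = 480 := by norm_num
  rw [hK]
  have h1 : N * Real.log (2 / (2 - 31 / 16)) ≤ 32 * M * 5 :=
    mul_le_mul hN32 hlog32 (Real.log_nonneg (by norm_num)) (by positivity)
  nlinarith

end Literature.NumberTheory.LFunctions
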